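import Summits.AtomisticToContinuum.HydrodynamicLimit.Theses.CollisionIsometryCLT
import Summits.AtomisticToContinuum.HydrodynamicLimit.Theses.StiffCollisionalRelaxation
import Summits.AtomisticToContinuum.HydrodynamicLimit.Theorems.CollisionIsometryCLTCollisionalTransferLocalityDefs
import Summits.AtomisticToContinuum.HydrodynamicLimit.Theorems.CollisionIsometryCLTCollisionalTransferLocalityDefsB
import Summits.AtomisticToContinuum.HydrodynamicLimit.Theorems.CollisionIsometryCLTCollisionalTransferLocalityDefsC
import Summits.AtomisticToContinuum.HydrodynamicLimit.Theorems.CollisionIsometryCLTCollisionalTransferLocalityBalanceIdentity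
import Summits.AtomisticToContinuum.HydrodynamicLimit.Theorems.CollisionIsometryCLTCollisionalTransferLocalityMarkedReduction
import Summits.AtomisticToContinuum.HydrodynamicLimit.Theorems.CollisionIsometryCLTCollisionalTransferLocalityChannelAdditivity
import Summits.AtomisticToContinuum.HydrodynamicLimit.Theorems.CollisionIsometryCLTCollisionalTransferLocalityWeightedKineticRelaxationDilute
import Summits.AtomisticToContinuum.HydrodynamicLimit.Theorems.CollisionIsometryCLTCollisionalTransferLocalityEnergyAllTimes
import Summits.AtomisticToContinuum.HydrodynamicLimit.Theorems.CollisionIsometryCLTCollisionalTransferLocalityCompressibilityLinear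
import Summits.AtomisticToContinuum.HydrodynamicLimit.Theorems.CollisionIsometryCLTCollisionalTransferLocalityVirialBoundedOfCollisionMomentBound
import Summits.AtomisticToContinuum.HydrodynamicLimit.Theorems.CollisionIsometryCLTCollisionalTransferLocalityDiluteBlocksOfKineticRangeControl
import Summits.AtomisticToContinuum.HydrodynamicLimit.Theses.InformationPercolationEngine
import Summits.AtomisticToContinuum.HydrodynamicLimit.Theses.GermanoSplitLES
import HarnessLib

/-!
# The two ENGINE ITEMS of crux `CollisionalTransferLocality` (stmt-AtomisticToContinuum-9518) in ROUTE VOCABULARY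

Crux workfile of the line lead (seat c9, line `hemisphere-affine-slaving`, skeleton v17). After sixteen skeleton versions and
≈ 60 landed files, the line closes the crux BY NAME from route items modulo exactly two research statements, one per channel
(registered stubs [Kσ] `stub_collisionalStressLaw` and [Kq] `stub_collisionalEnergyFluxLaw` of `Lines/hemisphere_affine_slaving.lean`),
the provable glue [G2] and — for the filed `∀ t` form only — the `∀ t` ceiling [S']. The two research statements are written in the
LINE's vocabulary (`Mfun`, `Rhs`, `Kfun`, `VirialBounded`, `DiluteAt`, …, files …CollisionalTransferLocalityDefs{,B,C}), which a
route file cannot import. This file gives the SAME two statements fully inlined in route vocabulary (only `Mathlib`, `Literature.*`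
names and `let`-telescopes, exactly as route decls are written), kernel-checked, together with the proof that each inlined item
IMPLIES the registered stub (`collisionalStressLaw_of_item`, `collisionalEnergyFluxLaw_of_item`) — so that a planner can file them
verbatim (one shared engine item per channel, or their conjunction) and the skeleton then closes 9518 from named items:
filed `∀ t` form ⟸ 9522 + 15144 + [Kσ] + [Kq] + [S'] (`collisionalTransferLocality_of_items`, the glue [G2] is LANDED p139073);
pre-shock form (`…DefsB.CollisionalTransferLocalityPreShock`, seat c1's C′) ⟸ 9522 + 15144 + 9201 + [Kσ] + [Kq], no `∀ t` input
(`collisionalTransferLocalityPreShock_of_items`).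

* `MesoscaleCollisionalStressLaw` [Kσ]: for all nice profiles ∃ σ₀ ∃ η₁ ∀ σ < σ₀ ∀ flow families ∀ t > 0, [V] (tightness of the
  weighted collision virial on (0, t]) → ∀ admissible kernels, [dilute event at level η₁ on [0, t]] → ∀ smooth vector tests ψ on
  [0, t]: uniformly in τ ≤ t, in local-Gibbs probability, the flux-form EVEN RANK-2 mark sum
  `M(τ) = (N+1)⁻¹ Σ_{ordered contacts, s_c ≤ τ} (ε_N/2)‖Δv_i‖ ω⊗ω:∇ψ(s_c, x_i)` equals
  `W₁(τ) + W₂(τ) = ∫₀^τ∫ div ψ · p_c(ρ̄, θ̄) + ∫₀^τ∫ (2/5)(D̄:∇ψ)/(ρ̄θ̄) · p_c(ρ̄, θ̄)` — the collisional stress is isotropic and the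
  local thermodynamic function `p_c = hsPressure σ ρ̄ θ̄ − ρ̄θ̄` of the block fields (plus the kinetic correction, removed by 9522).
* `MesoscaleCollisionalEnergyFluxLaw` [Kq]: same prefix, ∀ smooth scalar tests χ: the CUBIC mark sum
  `M(τ) = (N+1)⁻¹ Σ (ε_N/2)‖Δv_i‖ (V·ω)(ω·∇χ(s_c, x_i))` equals `∫₀^τ∫ (∇χ·ū) p_c + ∫₀^τ∫ [(2/5)(D̄ū)·∇χ + (3/5) q̄·∇χ]/(ρ̄θ̄) · p_c` —
  the collisional energy flux is `p_c ū`, no collisional heat flux at leading order.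
The value is written as a SUM of two double integrals (Euler part + kinetic correction), as in the line (`Rhs + Kfun`): merging them
into one integral would differ by Bochner junk on non-integrable configurations.

Nothing here is asserted: the two `def … : Prop` are item texts; the theorems are unconditional bridges (definitional unfolding plus
`∇0 = 0`, `div 0 = 0`).
-/

namespace Summit.AtomisticToContinuum.HydrodynamicLimit.Theorems.HemisphereAffineSlaving.EngineItems

open scoped BigOperators Topology Classical ENNReal InnerProductSpace
open Filter Set Function MeasureTheory
open Summit.AtomisticToContinuum.HydrodynamicLimit.Theorems.HemisphereAffineSlaving

noncomputable section

open Literature.MathematicalPhysics.KineticTheory (T3 V3)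

/-! ## The two item texts (route vocabulary only) -/

/-- **[Kσ] THE MESOSCALE COLLISIONAL-STRESS LAW** (momentum channel of crux 9518; item text, route vocabulary). See the module
docstring. Implies the registered stub `stub_collisionalStressLaw` (`collisionalStressLaw_of_item`). -/
def MesoscaleCollisionalStressLaw : Prop :=
  ∀ (a₀ θ₀ : (UnitAddTorus (Fin 3)) → ℝ) (u₀ : (UnitAddTorus (Fin 3)) → (EuclideanSpace ℝ (Fin 3))), Continuous a₀ → Continuous θ₀ → Continuous u₀ → (∀ x, 0 < a₀ x) → (∀ x, 0 < θ₀ x) → ∃ σ₀ : ℝ, 0 < σ₀ ∧ ∃ η₁ : ℝ, 0 < η₁ ∧ ∀ σ : ℝ, 0 < σ → σ < σ₀ → ∀ Φ : (N : ℕ) → Literature.Analysis.FluidPDE.HardSphereFlow (Literature.Analysis.FluidPDE.Torus.geometry (Fin 3)) (Literature.MathematicalPhysics.KineticTheory.hsDiameter σ N) (N + 1), ∀ t : ℝ, 0 < t → let dv := fun (N : ℕ) (w : Literature.Analysis.FluidPDE.Config (N + 1) (Fin 3) (UnitAddTorus (Fin 3))) (i j : Fin (N + 1)) => (w i).2 -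 (Literature.Analysis.FluidPDE.reflectVel ((Literature.Analysis.FluidPDE.Torus.geometry (Fin 3)).sepVec (w i).1 (w j).1) ((w i).2, (w j).2)).1; let V := fun (N : ℕ) (z : Literature.Analysis.FluidPDE.Config (N + 1) (Fin 3) (UnitAddTorus (Fin 3))) (τ : ℝ) => ((N : ℝ) + 1)⁻¹ * (Φ N).collisionPairSum (Ioc 0 τ) (fun (_ : ℝ) (w : Literature.Analysis.FluidPDE.Config (N + 1) (Fin 3) (UnitAddTorus (Fin 3))) (i j : Fin (N + 1)) => Literature.MathematicalPhysics.KineticTheory.hsDiameter σ N * ‖dv N w i j‖ * (1 + ‖(w i).2‖ + ‖(w j).2‖)) z; (∀ δ : ℝ, 0 < δ → ∃ K : ℝ, ∀ᶠ N : ℕ in atTop, Literature.MathematicalPhysics.KineticTheory.localGibbsLaw σ a₀ u₀ θ₀ N (Φ N) {z | K < V N z t} ≤ ENNReal.ofReal δ) → ∀ (γ C : ℝ) (φ : ℕ → (UnitAddTorus (Fin 3)) → ℝ), 0 < γ → γ ≤ 1 / 15 → ((∀ N, Literature.Analysis.FunctionSpaces.Torus.IsSmooth (φ N)) ∧ (∀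 N y, 0 ≤ φ N y) ∧ (∀ N, ∫ y, φ N y = 1) ∧ (∀ (N : ℕ) y, ((N : ℝ) + 1) ^ (-γ) ≤ Literature.Analysis.FluidPDE.Torus.euclidDist y 0 → φ N y = 0) ∧ (∀ (N : ℕ) y, φ N y ≤ C * ((N : ℝ) + 1) ^ (3 * γ)) ∧ (∀ (N : ℕ) y, ‖Literature.Analysis.FunctionSpaces.Torus.gradient (φ N) y‖ ≤ C * ((N : ℝ) + 1) ^ (4 * γ))) → let ρb := fun (N : ℕ) (z : Literature.Analysis.FluidPDE.Config (N + 1) (Fin 3) (UnitAddTorus (Fin 3))) (x : (UnitAddTorus (Fin 3))) => Literature.MathematicalPhysics.KineticTheory.empiricalDensityField z (fun y => φ N (y - x)); let mb := fun (N : ℕ) (z : Literature.Analysis.FluidPDE.Config (N + 1) (Fin 3) (UnitAddTorus (Fin 3))) (x : (UnitAddTorus (Fin 3))) => Literature.MathematicalPhysics.KineticTheory.empiricalMomentumField z (fun y => φ N (y - x)); let Eb := fun (N : ℕ) (z : Literature.Analysis.FluidPDE.Config (N + 1) (Fin 3) (UnitAddTorus (Fin 3))) (x : (UnitAddTorus (Fin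 3))) => Literature.MathematicalPhysics.KineticTheory.empiricalEnergyField z (fun y => φ N (y - x)); let ub := fun (N : ℕ) (z : Literature.Analysis.FluidPDE.Config (N + 1) (Fin 3) (UnitAddTorus (Fin 3))) (x : (UnitAddTorus (Fin 3))) => (ρb N z x)⁻¹ • mb N z x; let θb := fun (N : ℕ) (z : Literature.Analysis.FluidPDE.Config (N + 1) (Fin 3) (UnitAddTorus (Fin 3))) (x : (UnitAddTorus (Fin 3))) => 2 / 3 * (Eb N z x / ρb N z x - ‖mb N z x‖ ^ 2 / (2 * ρb N z x ^ 2)); Tendsto (fun N : ℕ => Literature.MathematicalPhysics.KineticTheory.localGibbsLaw σ a₀ u₀ θ₀ N (Φ N) {z | ∃ s ∈ Icc 0 t, ∃ x : (UnitAddTorus (Fin 3)), η₁ < ρb N ((Φ N).flow s z) x * σ ^ 3}) atTop (𝓝 0) → ∀ ψ : ℝ → (UnitAddTorus (Fin 3)) → (EuclideanSpace ℝ (Fin 3)), Literature.Analysis.FunctionSpaces.Torus.IsSmoothSpaceTimeOn (Icc 0 t) ψ → let D := fun (N : ℕ) (z : Literature.Analysis.FluidPDE.Config (N + 1) (Fin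 3) (UnitAddTorus (Fin 3))) (x : (UnitAddTorus (Fin 3))) (j k : Fin 3) => (∫ y, φ N (y.1 - x) * ((y.2 j - ub N z x j) * (y.2 k - ub N z x k)) ∂(Literature.Analysis.FluidPDE.empiricalMeasure z)) - (if j = k then (∑ l : Fin 3, ∫ y, φ N (y.1 - x) * (y.2 l - ub N z x l) ^ 2 ∂(Literature.Analysis.FluidPDE.empiricalMeasure z)) / 3 else 0); let pc := fun (r th : ℝ) => Literature.MathematicalPhysics.KineticTheory.hsPressure σ r th - r * th; let nrm := fun (N : ℕ) (w : Literature.Analysis.FluidPDE.Config (N + 1) (Fin 3) (UnitAddTorus (Fin 3))) (i j : Fin (N + 1)) => (Literature.Analysis.FluidPDE.Torus.geometry (Fin 3)).sepVec (w i).1 (w j).1; let ω := fun (N : ℕ) (w : Literature.Analysis.FluidPDE.Config (N + 1) (Fin 3) (UnitAddTorus (Fin 3))) (i j : Fin (N + 1)) => ‖nrm N w i j‖⁻¹ • nrm N w i j; let M := fun (N : ℕ) (z : Literature.Analysis.FluidPDE.Config (N + 1) (Fin 3) (UnitAddTorus (Fin 3))) (τ : ℝ) => ((N : ℝ) + 1)⁻¹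 * (Φ N).collisionPairSum (Ioc 0 τ) (fun (s : ℝ) (w : Literature.Analysis.FluidPDE.Config (N + 1) (Fin 3) (UnitAddTorus (Fin 3))) (i j : Fin (N + 1)) => Literature.MathematicalPhysics.KineticTheory.hsDiameter σ N / 2 * ‖dv N w i j‖ * ∑ a, ∑ b, ω N w i j a * ω N w i j b * Literature.Analysis.FunctionSpaces.Torus.gradient (fun y => ψ s y a) (w i).1 b) z; let W₁ := fun (N : ℕ) (z : Literature.Analysis.FluidPDE.Config (N + 1) (Fin 3) (UnitAddTorus (Fin 3))) (τ : ℝ) => ∫ s in Icc 0 τ, ∫ x, Literature.Analysis.FunctionSpaces.Torus.divergence (ψ s) x * pc (ρb N ((Φ N).flow s z) x) (θb N ((Φ N).flow s z) x); let W₂ := fun (N : ℕ) (z : Literature.Analysis.FluidPDE.Config (N + 1) (Fin 3) (UnitAddTorus (Fin 3))) (τ : ℝ) => ∫ s in Icc 0 τ, ∫ x, 2 / 5 * (∑ a, ∑ b, D N ((Φ N).flow s z) x a b * Literature.Analysis.FunctionSpaces.Torus.gradient (fun y => ψ s y a) x b) / (ρb N ((Φ N).flow s z) x * θb N ((Φ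 N).flow s z) x) * pc (ρb N ((Φ N).flow s z) x) (θb N ((Φ N).flow s z) x); ∀ δ : ℝ, 0 < δ → Tendsto (fun N : ℕ => Literature.MathematicalPhysics.KineticTheory.localGibbsLaw σ a₀ u₀ θ₀ N (Φ N) {z | ∃ τ ∈ Icc 0 t, δ < |M N z τ - (W₁ N z τ + W₂ N z τ)|}) atTop (𝓝 0)

/-- **[Kq] THE MESOSCALE COLLISIONAL-ENERGY-FLUX LAW** (energy channel of crux 9518; item text, route vocabulary). See the module
docstring. Implies the registered stub `stub_collisionalEnergyFluxLaw` (`collisionalEnergyFluxLaw_of_item`). -/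
def MesoscaleCollisionalEnergyFluxLaw : Prop :=
  ∀ (a₀ θ₀ : (UnitAddTorus (Fin 3)) → ℝ) (u₀ : (UnitAddTorus (Fin 3)) → (EuclideanSpace ℝ (Fin 3))), Continuous a₀ → Continuous θ₀ → Continuous u₀ → (∀ x, 0 < a₀ x) → (∀ x, 0 < θ₀ x) → ∃ σ₀ : ℝ, 0 < σ₀ ∧ ∃ η₁ : ℝ, 0 < η₁ ∧ ∀ σ : ℝ, 0 < σ → σ < σ₀ → ∀ Φ : (N : ℕ) → Literature.Analysis.FluidPDE.HardSphereFlow (Literature.Analysis.FluidPDE.Torus.geometry (Fin 3)) (Literature.MathematicalPhysics.KineticTheory.hsDiameter σ N) (N + 1), ∀ t : ℝ, 0 < t → let dv := fun (N : ℕ) (w : Literature.Analysis.FluidPDE.Config (N + 1) (Fin 3) (UnitAddTorus (Fin 3))) (i j : Fin (N + 1)) => (w i).2 - (Literature.Analysis.FluidPDE.reflectVel ((Literature.Analysis.FluidPDE.Torus.geometry (Fin 3)).sepVec (w i).1 (w j).1) ((w i).2, (w j).2)).1; let V := fun (N : ℕ) (z : Literature.Analysis.FluidPDE.Config (N + 1)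 (Fin 3) (UnitAddTorus (Fin 3))) (τ : ℝ) => ((N : ℝ) + 1)⁻¹ * (Φ N).collisionPairSum (Ioc 0 τ) (fun (_ : ℝ) (w : Literature.Analysis.FluidPDE.Config (N + 1) (Fin 3) (UnitAddTorus (Fin 3))) (i j : Fin (N + 1)) => Literature.MathematicalPhysics.KineticTheory.hsDiameter σ N * ‖dv N w i j‖ * (1 + ‖(w i).2‖ + ‖(w j).2‖)) z; (∀ δ : ℝ, 0 < δ → ∃ K : ℝ, ∀ᶠ N : ℕ in atTop, Literature.MathematicalPhysics.KineticTheory.localGibbsLaw σ a₀ u₀ θ₀ N (Φ N) {z | K < V N z t} ≤ ENNReal.ofReal δ) → ∀ (γ C : ℝ) (φ : ℕ → (UnitAddTorus (Fin 3)) → ℝ), 0 < γ → γ ≤ 1 / 15 → ((∀ N, Literature.Analysis.FunctionSpaces.Torus.IsSmooth (φ N)) ∧ (∀ N y, 0 ≤ φ N y) ∧ (∀ N, ∫ y, φ N y = 1) ∧ (∀ (N : ℕ) y, ((N : ℝ) + 1) ^ (-γ) ≤ Literature.Analysis.FluidPDE.Torus.euclidDist y 0 → φ N y = 0) ∧ (∀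 (N : ℕ) y, φ N y ≤ C * ((N : ℝ) + 1) ^ (3 * γ)) ∧ (∀ (N : ℕ) y, ‖Literature.Analysis.FunctionSpaces.Torus.gradient (φ N) y‖ ≤ C * ((N : ℝ) + 1) ^ (4 * γ))) → let ρb := fun (N : ℕ) (z : Literature.Analysis.FluidPDE.Config (N + 1) (Fin 3) (UnitAddTorus (Fin 3))) (x : (UnitAddTorus (Fin 3))) => Literature.MathematicalPhysics.KineticTheory.empiricalDensityField z (fun y => φ N (y - x)); let mb := fun (N : ℕ) (z : Literature.Analysis.FluidPDE.Config (N + 1) (Fin 3) (UnitAddTorus (Fin 3))) (x : (UnitAddTorus (Fin 3))) => Literature.MathematicalPhysics.KineticTheory.empiricalMomentumField z (fun y => φ N (y - x)); let Eb := fun (N : ℕ) (z : Literature.Analysis.FluidPDE.Config (N + 1) (Fin 3) (UnitAddTorus (Fin 3))) (x : (UnitAddTorus (Fin 3))) => Literature.MathematicalPhysics.KineticTheory.empiricalEnergyField z (fun y => φ N (y - x)); let ub := fun (N : ℕ) (z : Literature.Analysis.FluidPDE.Config (N + 1) (Fin 3) (UnitAddTorus (Fin 3))) (x : (UnitAddTorus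 (Fin 3))) => (ρb N z x)⁻¹ • mb N z x; let θb := fun (N : ℕ) (z : Literature.Analysis.FluidPDE.Config (N + 1) (Fin 3) (UnitAddTorus (Fin 3))) (x : (UnitAddTorus (Fin 3))) => 2 / 3 * (Eb N z x / ρb N z x - ‖mb N z x‖ ^ 2 / (2 * ρb N z x ^ 2)); Tendsto (fun N : ℕ => Literature.MathematicalPhysics.KineticTheory.localGibbsLaw σ a₀ u₀ θ₀ N (Φ N) {z | ∃ s ∈ Icc 0 t, ∃ x : (UnitAddTorus (Fin 3)), η₁ < ρb N ((Φ N).flow s z) x * σ ^ 3}) atTop (𝓝 0) → ∀ χ : ℝ → (UnitAddTorus (Fin 3)) → ℝ, Literature.Analysis.FunctionSpaces.Torus.IsSmoothSpaceTimeOn (Icc 0 t) χ → let D := fun (N : ℕ) (z : Literature.Analysis.FluidPDE.Config (N + 1) (Fin 3) (UnitAddTorus (Fin 3))) (x : (UnitAddTorus (Fin 3))) (j k : Fin 3) => (∫ y, φ N (y.1 - x) * ((y.2 j - ub N z x j) * (y.2 k - ub N z x k)) ∂(Literature.Analysis.FluidPDE.empiricalMeasure z)) - (if j = k then (∑ l :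 Fin 3, ∫ y, φ N (y.1 - x) * (y.2 l - ub N z x l) ^ 2 ∂(Literature.Analysis.FluidPDE.empiricalMeasure z)) / 3 else 0); let q := fun (N : ℕ) (z : Literature.Analysis.FluidPDE.Config (N + 1) (Fin 3) (UnitAddTorus (Fin 3))) (x : (UnitAddTorus (Fin 3))) => ∫ y, (φ N (y.1 - x) * ‖y.2 - ub N z x‖ ^ 2 / 2) • (y.2 - ub N z x) ∂(Literature.Analysis.FluidPDE.empiricalMeasure z); let pc := fun (r th : ℝ) => Literature.MathematicalPhysics.KineticTheory.hsPressure σ r th - r * th; let nrm := fun (N : ℕ) (w : Literature.Analysis.FluidPDE.Config (N + 1) (Fin 3) (UnitAddTorus (Fin 3))) (i j : Fin (N + 1)) => (Literature.Analysis.FluidPDE.Torus.geometry (Fin 3)).sepVec (w i).1 (w j).1; let ω := fun (N : ℕ) (w : Literature.Analysis.FluidPDE.Config (N + 1) (Fin 3) (UnitAddTorus (Fin 3))) (i j : Fin (N + 1)) => ‖nrm N w i j‖⁻¹ • nrm N w i j; let M := fun (N : ℕ) (z : Literature.Analysis.FluidPDE.Config (N + 1) (Fin 3) (UnitAddTorus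 (Fin 3))) (τ : ℝ) => ((N : ℝ) + 1)⁻¹ * (Φ N).collisionPairSum (Ioc 0 τ) (fun (s : ℝ) (w : Literature.Analysis.FluidPDE.Config (N + 1) (Fin 3) (UnitAddTorus (Fin 3))) (i j : Fin (N + 1)) => Literature.MathematicalPhysics.KineticTheory.hsDiameter σ N / 2 * ‖dv N w i j‖ * (inner ℝ ((1 / 2 : ℝ) • ((w i).2 + (w j).2)) (ω N w i j) * ∑ a, ω N w i j a * Literature.Analysis.FunctionSpaces.Torus.gradient (χ s) (w i).1 a)) z; let W₁ := fun (N : ℕ) (z : Literature.Analysis.FluidPDE.Config (N + 1) (Fin 3) (UnitAddTorus (Fin 3))) (τ : ℝ) => ∫ s in Icc 0 τ, ∫ x, (∑ j, Literature.Analysis.FunctionSpaces.Torus.gradient (χ s) x j * ub N ((Φ N).flow s z) x j) * pc (ρb N ((Φ N).flow s z) x) (θb N ((Φ N).flow s z) x); let W₂ := fun (N : ℕ) (z : Literature.Analysis.FluidPDE.Config (N + 1) (Fin 3) (UnitAddTorus (Fin 3))) (τ : ℝ) => ∫ s in Icc 0 τ, ∫ x, (2 / 5 * (∑ a, ∑ b,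 D N ((Φ N).flow s z) x a b * ub N ((Φ N).flow s z) x b * Literature.Analysis.FunctionSpaces.Torus.gradient (χ s) x a) / (ρb N ((Φ N).flow s z) x * θb N ((Φ N).flow s z) x) + 3 / 5 * (∑ a, q N ((Φ N).flow s z) x a * Literature.Analysis.FunctionSpaces.Torus.gradient (χ s) x a) / (ρb N ((Φ N).flow s z) x * θb N ((Φ N).flow s z) x)) * pc (ρb N ((Φ N).flow s z) x) (θb N ((Φ N).flow s z) x); ∀ δ : ℝ, 0 < δ → Tendsto (fun N : ℕ => Literature.MathematicalPhysics.KineticTheory.localGibbsLaw σ a₀ u₀ θ₀ N (Φ N) {z | ∃ τ ∈ Icc 0 t, δ < |M N z τ - (W₁ N z τ + W₂ N z τ)|}) atTop (𝓝 0)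

/-! ## `∇0 = 0`, `div 0 = 0` on the torus, and the line's kernels at a zero test -/

/-- The torus gradient of a constant scalar vanishes. [folklore] -/
theorem torusGradient_const (c : ℝ) (x : T3) :
    Literature.Analysis.FunctionSpaces.Torus.gradient (fun _ : T3 => c) x = 0 := by
  show _root_.gradient (fun _ : EuclideanSpace ℝ (Fin 3) => c) 0 = 0
  exact gradient_fun_const (0 : EuclideanSpace ℝ (Fin 3)) c

/-- The torus divergence of the zero vector field vanishes. [folklore] -/
theorem torusDivergence_zero (x : T3) :
    Literature.Analysis.FunctionSpaces.Torus.divergence (fun _ : T3 => (0 : V3)) x = 0 := by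
  simp [Literature.Analysis.FunctionSpaces.Torus.divergence, Literature.Analysis.FunctionSpaces.Torus.partialDeriv,
    Literature.Analysis.FunctionSpaces.Torus.lineDeriv]

/-- `gradChi 0 = 0`. -/
theorem gradChi_zero (s : ℝ) (x : T3) : gradChi (fun (_ : ℝ) (_ : T3) => (0 : ℝ)) s x = 0 :=
  torusGradient_const 0 x

/-- `gradPsi 0 = 0`. -/
theorem gradPsi_zero (s : ℝ) (x : T3) (a b : Fin 3) : gradPsi (fun (_ : ℝ) (_ : T3) => (0 : V3)) s x a b = 0 := by
  simp only [gradPsi, PiLp.zero_apply, torusGradient_const]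

/-- `divPsi 0 = 0`. -/
theorem divPsi_zero (s : ℝ) (x : T3) : divPsi (fun (_ : ℝ) (_ : T3) => (0 : V3)) s x = 0 :=
  torusDivergence_zero x

/-- The flux-form mark kernel at `χ ≡ 0` is the stress-mark kernel (as functions of `(s, w, i, j)`). -/
theorem markK_zero_chi (σ : ℝ) (ψ : ℝ → T3 → V3) (N : ℕ) :
    markK σ ψ (fun (_ : ℝ) (_ : T3) => (0 : ℝ)) N = fun (s : ℝ) (w : Cfg N) (i j : Fin (N + 1)) =>
      Literature.MathematicalPhysics.KineticTheory.hsDiameter σ N / 2 * ‖dV N w i j‖ *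
        ∑ a, ∑ b, omg N w i j a * omg N w i j b * gradPsi ψ s (w i).1 a b := by
  funext s w i j
  simp [markK, gradChi_zero]

/-- The flux-form mark kernel at `ψ ≡ 0` is the energy-mark kernel (as functions of `(s, w, i, j)`). -/
theorem markK_zero_psi (σ : ℝ) (χ : ℝ → T3 → ℝ) (N : ℕ) :
    markK σ (fun (_ : ℝ) (_ : T3) => (0 : V3)) χ N = fun (s : ℝ) (w : Cfg N) (i j : Fin (N + 1)) =>
      Literature.MathematicalPhysics.KineticTheory.hsDiameter σ N / 2 * ‖dV N w i j‖ *
        (⟪Vcm N w i j, omg N w i j⟫_ℝ * ∑ a, omg N w i j a * gradChi χ s (w i).1 a) := by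
  funext s w i j
  simp [markK, gradPsi_zero]

/-- The Euler weight at `χ ≡ 0` is `div ψ`. -/
theorem eulerW_zero_chi (ψ : ℝ → T3 → V3) (φ : ℕ → T3 → ℝ) (N : ℕ) (s : ℝ) (z : Cfg N) (x : T3) :
    eulerW ψ (fun (_ : ℝ) (_ : T3) => (0 : ℝ)) φ N s z x = divPsi ψ s x := by
  simp [eulerW, gradChi_zero]

/-- The Euler weight at `ψ ≡ 0` is `∇χ·ū`. -/
theorem eulerW_zero_psi (χ : ℝ → T3 → ℝ) (φ : ℕ → T3 → ℝ) (N : ℕ) (s : ℝ) (z : Cfg N) (x : T3) :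
    eulerW (fun (_ : ℝ) (_ : T3) => (0 : V3)) χ φ N s z x = ∑ j, gradChi χ s x j * uB φ N z x j := by
  simp [eulerW, divPsi_zero]

/-- The kinetic-correction weight at `χ ≡ 0`. -/
theorem kinW_zero_chi (ψ : ℝ → T3 → V3) (φ : ℕ → T3 → ℝ) (N : ℕ) (s : ℝ) (z : Cfg N) (x : T3) :
    kinW ψ (fun (_ : ℝ) (_ : T3) => (0 : ℝ)) φ N s z x =
      2 / 5 * (∑ a, ∑ b, Dst φ N z x a b * gradPsi ψ s x a b) / pkin φ N z x := by
  simp [kinW, gradChi_zero]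

/-- The kinetic-correction weight at `ψ ≡ 0`. -/
theorem kinW_zero_psi (χ : ℝ → T3 → ℝ) (φ : ℕ → T3 → ℝ) (N : ℕ) (s : ℝ) (z : Cfg N) (x : T3) :
    kinW (fun (_ : ℝ) (_ : T3) => (0 : V3)) χ φ N s z x =
      2 / 5 * (∑ a, ∑ b, Dst φ N z x a b * uB φ N z x b * gradChi χ s x a) / pkin φ N z x +
        3 / 5 * (∑ a, qfl φ N z x a * gradChi χ s x a) / pkin φ N z x := by
  simp [kinW, gradPsi_zero]

/-! ## Bridges: each item implies the registered engine stub of the skeleton (v17) -/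

/-- **[Kσ] item ⇒ registered stub `stub_collisionalStressLaw`** (its signature verbatim as the conclusion; definitional unfolding
of the line vocabulary plus `∇0 = 0`). -/
theorem collisionalStressLaw_of_item (h : MesoscaleCollisionalStressLaw) : ∀ (a₀ θ₀ : T3 → ℝ) (u₀ : T3 → V3), NiceProfiles a₀ θ₀ u₀ → ∃ σ₀ : ℝ, 0 < σ₀ ∧ ∃ η₁ : ℝ, 0 < η₁ ∧ ∀ σ : ℝ, 0 < σ → σ < σ₀ → ∀ (Φ : Flows σ) (t : ℝ), 0 < t → VirialBounded σ a₀ θ₀ u₀ Φ t → ∀ (γ C : ℝ) (φ : ℕ → T3 → ℝ), 0 < γ → γ ≤ 1 / 15 → AdmissibleKernel γ C φ → DiluteAt σ a₀ θ₀ u₀ Φ t φ η₁ → ∀ (ψ : ℝ → T3 → V3), Literature.Analysis.FunctionSpaces.Torus.IsSmoothSpaceTimeOn (Icc 0 t) ψ → ∀ δ : ℝ, 0 < δ → Tendsto (fun N : ℕ => Literature.MathematicalPhysics.KineticTheory.localGibbsLaw σ a₀ u₀ θ₀ N (Φ N) {z | ∃ τ ∈ Icc 0 t, δ < |Mfun σ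 Φ ψ (fun (_ : ℝ) (_ : T3) => (0 : ℝ)) N z τ - (Rhs σ Φ φ ψ (fun (_ : ℝ) (_ : T3) => (0 : ℝ)) N z τ + Kfun σ Φ φ ψ (fun (_ : ℝ) (_ : T3) => (0 : ℝ)) N z τ)|}) atTop (𝓝 0) := by
  intro a₀ θ₀ u₀ hP
  obtain ⟨σ₀, hσ₀, η₁, hη₁, H⟩ := h a₀ θ₀ u₀ hP.1 hP.2.1 hP.2.2.1 hP.2.2.2.1 hP.2.2.2.2
  refine ⟨σ₀, hσ₀, η₁, hη₁, ?_⟩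
  intro σ hσ hlt Φ t ht hV γ C φ hγ hγ' hadm hD ψ hψ δ hδ
  have H' := H σ hσ hlt Φ t ht hV γ C φ hγ hγ' hadm hD ψ hψ δ hδ
  simpa only [Mfun, Rhs, Kfun, markK_zero_chi, eulerW_zero_chi, kinW_zero_chi, dV, omg, sepV, Vcm, gradPsi, gradChi, divPsi, pcoll, pkin, rhoB, thetaB, EB, mB, uB, Dst, qfl] using H'

/-- **[Kq] item ⇒ registered stub `stub_collisionalEnergyFluxLaw`.** -/
theorem collisionalEnergyFluxLaw_of_item (h : MesoscaleCollisionalEnergyFluxLaw) : ∀ (a₀ θ₀ : T3 → ℝ) (u₀ : T3 → V3), NiceProfiles a₀ θ₀ u₀ → ∃ σ₀ : ℝ, 0 < σ₀ ∧ ∃ η₁ : ℝ, 0 < η₁ ∧ ∀ σ : ℝ, 0 < σ → σ < σ₀ → ∀ (Φ : Flows σ) (t : ℝ), 0 < t → VirialBounded σ a₀ θ₀ u₀ Φ t → ∀ (γ C : ℝ) (φ : ℕ → T3 → ℝ), 0 < γ → γ ≤ 1 / 15 → AdmissibleKernel γ C φ → DiluteAt σ a₀ θ₀ u₀ Φ t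 φ η₁ → ∀ (χ : ℝ → T3 → ℝ), Literature.Analysis.FunctionSpaces.Torus.IsSmoothSpaceTimeOn (Icc 0 t) χ → ∀ δ : ℝ, 0 < δ → Tendsto (fun N : ℕ => Literature.MathematicalPhysics.KineticTheory.localGibbsLaw σ a₀ u₀ θ₀ N (Φ N) {z | ∃ τ ∈ Icc 0 t, δ < |Mfun σ Φ (fun (_ : ℝ) (_ : T3) => (0 : V3)) χ N z τ - (Rhs σ Φ φ (fun (_ : ℝ) (_ : T3) => (0 : V3)) χ N z τ + Kfun σ Φ φ (fun (_ : ℝ) (_ : T3) => (0 : V3)) χ N z τ)|}) atTop (𝓝 0) := by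
  intro a₀ θ₀ u₀ hP
  obtain ⟨σ₀, hσ₀, η₁, hη₁, H⟩ := h a₀ θ₀ u₀ hP.1 hP.2.1 hP.2.2.1 hP.2.2.2.1 hP.2.2.2.2
  refine ⟨σ₀, hσ₀, η₁, hη₁, ?_⟩
  intro σ hσ hlt Φ t ht hV γ C φ hγ hγ' hadm hD χ hχ δ hδ
  have H' := H σ hσ hlt Φ t ht hV γ C φ hγ hγ' hadm hD χ hχ δ hδ
  simpa only [Mfun, Rhs, Kfun, markK_zero_psi, eulerW_zero_psi, kinW_zero_psi, dV, omg, sepV, Vcm, gradPsi, gradChi, divPsi, pcoll, pkin, rhoB, thetaB, EB, mB, uB, Dst, qfl] using H'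

/-! ## Converses: the registered stubs imply the items (so each item is EXACTLY the stub, restated) -/

/-- **Registered stub `stub_collisionalStressLaw` ⇒ [Kσ] item.** -/
theorem item_of_collisionalStressLaw (h : ∀ (a₀ θ₀ : T3 → ℝ) (u₀ : T3 → V3), NiceProfiles a₀ θ₀ u₀ → ∃ σ₀ : ℝ, 0 < σ₀ ∧ ∃ η₁ : ℝ, 0 < η₁ ∧ ∀ σ : ℝ, 0 < σ → σ < σ₀ → ∀ (Φ : Flows σ) (t : ℝ), 0 < t → VirialBounded σ a₀ θ₀ u₀ Φ t → ∀ (γ C : ℝ) (φ : ℕ → T3 → ℝ), 0 < γ → γ ≤ 1 / 15 → AdmissibleKernel γ C φ → DiluteAt σ a₀ θ₀ u₀ Φ t φ η₁ → ∀ (ψ : ℝ → T3 → V3), Literature.Analysis.FunctionSpaces.Torus.IsSmoothSpaceTimeOn (Icc 0 t) ψ → ∀ δ : ℝ, 0 < δ → Tendsto (fun N : ℕ => Literature.MathematicalPhysics.KineticTheory.localGibbsLaw σ a₀ u₀ θ₀ N (Φ N) {z | ∃ τ ∈ Icc 0 t, δ < |Mfun σ Φ ψ (fun (_ : ℝ)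 (_ : T3) => (0 : ℝ)) N z τ - (Rhs σ Φ φ ψ (fun (_ : ℝ) (_ : T3) => (0 : ℝ)) N z τ + Kfun σ Φ φ ψ (fun (_ : ℝ) (_ : T3) => (0 : ℝ)) N z τ)|}) atTop (𝓝 0)) : MesoscaleCollisionalStressLaw := by
  intro a₀ θ₀ u₀ ha hθ hu ha0 hθ0
  obtain ⟨σ₀, hσ₀, η₁, hη₁, H⟩ := h a₀ θ₀ u₀ ⟨ha, hθ, hu, ha0, hθ0⟩
  refine ⟨σ₀, hσ₀, η₁, hη₁, ?_⟩
  intro σ hσ hlt Φ t ht dv V hV γ C φ hγ hγ' hadm ρb mb Eb ub θb hD ψ hψ D pc nrm ω M W₁ W₂ δ hδ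
  have H' := H σ hσ hlt Φ t ht hV γ C φ hγ hγ' hadm hD ψ hψ δ hδ
  simpa only [Mfun, Rhs, Kfun, markK_zero_chi, eulerW_zero_chi, kinW_zero_chi, dV, omg, sepV, Vcm, gradPsi, gradChi, divPsi, pcoll, pkin, rhoB, thetaB, EB, mB, uB, Dst, qfl] using H'

/-- **Registered stub `stub_collisionalEnergyFluxLaw` ⇒ [Kq] item.** -/
theorem item_of_collisionalEnergyFluxLaw (h : ∀ (a₀ θ₀ : T3 → ℝ) (u₀ : T3 → V3), NiceProfiles a₀ θ₀ u₀ → ∃ σ₀ : ℝ, 0 < σ₀ ∧ ∃ η₁ : ℝ, 0 < η₁ ∧ ∀ σ : ℝ, 0 < σ → σ < σ₀ → ∀ (Φ : Flows σ) (t : ℝ), 0 < t → VirialBounded σ a₀ θ₀ u₀ Φ t → ∀ (γ C : ℝ) (φ : ℕ → T3 → ℝ), 0 < γ → γ ≤ 1 / 15 → AdmissibleKernel γ C φ → DiluteAt σ a₀ θ₀ u₀ Φ t φ η₁ → ∀ (χ : ℝ → T3 → ℝ), Literature.Analysis.FunctionSpaces.Torus.IsSmoothSpaceTimeOn (Icc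 0 t) χ → ∀ δ : ℝ, 0 < δ → Tendsto (fun N : ℕ => Literature.MathematicalPhysics.KineticTheory.localGibbsLaw σ a₀ u₀ θ₀ N (Φ N) {z | ∃ τ ∈ Icc 0 t, δ < |Mfun σ Φ (fun (_ : ℝ) (_ : T3) => (0 : V3)) χ N z τ - (Rhs σ Φ φ (fun (_ : ℝ) (_ : T3) => (0 : V3)) χ N z τ + Kfun σ Φ φ (fun (_ : ℝ) (_ : T3) => (0 : V3)) χ N z τ)|}) atTop (𝓝 0)) : MesoscaleCollisionalEnergyFluxLaw := by
  intro a₀ θ₀ u₀ ha hθ hu ha0 hθ0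
  obtain ⟨σ₀, hσ₀, η₁, hη₁, H⟩ := h a₀ θ₀ u₀ ⟨ha, hθ, hu, ha0, hθ0⟩
  refine ⟨σ₀, hσ₀, η₁, hη₁, ?_⟩
  intro σ hσ hlt Φ t ht dv V hV γ C φ hγ hγ' hadm ρb mb Eb ub θb hD χ hχ D q pc nrm ω M W₁ W₂ δ hδ
  have H' := H σ hσ hlt Φ t ht hV γ C φ hγ hγ' hadm hD χ hχ δ hδ
  simpa only [Mfun, Rhs, Kfun, markK_zero_psi, eulerW_zero_psi, kinW_zero_psi, dV, omg, sepV, Vcm, gradPsi, gradChi, divPsi, pcoll, pkin, rhoB, thetaB, EB, mB, uB, Dst, qfl] using H'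

/-- [Kσ] item ⟺ registered stub. -/
theorem mesoscaleCollisionalStressLaw_iff : MesoscaleCollisionalStressLaw ↔ ∀ (a₀ θ₀ : T3 → ℝ) (u₀ : T3 → V3), NiceProfiles a₀ θ₀ u₀ → ∃ σ₀ : ℝ, 0 < σ₀ ∧ ∃ η₁ : ℝ, 0 < η₁ ∧ ∀ σ : ℝ, 0 < σ → σ < σ₀ → ∀ (Φ : Flows σ) (t : ℝ), 0 < t → VirialBounded σ a₀ θ₀ u₀ Φ t → ∀ (γ C : ℝ) (φ : ℕ → T3 → ℝ), 0 < γ → γ ≤ 1 / 15 → AdmissibleKernel γ C φ → DiluteAt σ a₀ θ₀ u₀ Φ t φ η₁ → ∀ (ψ : ℝ → T3 → V3), Literature.Analysis.FunctionSpaces.Torus.IsSmoothSpaceTimeOn (Icc 0 t) ψ → ∀ δ : ℝ, 0 < δ → Tendsto (fun N : ℕ => Literature.MathematicalPhysics.KineticTheory.localGibbsLaw σ a₀ u₀ θ₀ N (Φ N) {z | ∃ τ ∈ Icc 0 t, δ < |Mfun σ Φ ψ (fun (_ : ℝ) (_ : T3) => (0 : ℝ)) N z τ - (Rhs σ Φ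 φ ψ (fun (_ : ℝ) (_ : T3) => (0 : ℝ)) N z τ + Kfun σ Φ φ ψ (fun (_ : ℝ) (_ : T3) => (0 : ℝ)) N z τ)|}) atTop (𝓝 0) :=
  ⟨collisionalStressLaw_of_item, item_of_collisionalStressLaw⟩

/-- [Kq] item ⟺ registered stub. -/
theorem mesoscaleCollisionalEnergyFluxLaw_iff : MesoscaleCollisionalEnergyFluxLaw ↔ ∀ (a₀ θ₀ : T3 → ℝ) (u₀ : T3 → V3), NiceProfiles a₀ θ₀ u₀ → ∃ σ₀ : ℝ, 0 < σ₀ ∧ ∃ η₁ : ℝ, 0 < η₁ ∧ ∀ σ : ℝ, 0 < σ → σ < σ₀ → ∀ (Φ : Flows σ) (t : ℝ), 0 < t → VirialBounded σ a₀ θ₀ u₀ Φ t → ∀ (γ C : ℝ) (φ : ℕ → T3 → ℝ), 0 < γ → γ ≤ 1 / 15 → AdmissibleKernel γ C φ → DiluteAt σ a₀ θ₀ u₀ Φ t φ η₁ → ∀ (χ : ℝ → T3 → ℝ), Literature.Analysis.FunctionSpaces.Torus.IsSmoothSpaceTimeOn (Icc 0 t) χ → ∀ δ : ℝ, 0 <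 δ → Tendsto (fun N : ℕ => Literature.MathematicalPhysics.KineticTheory.localGibbsLaw σ a₀ u₀ θ₀ N (Φ N) {z | ∃ τ ∈ Icc 0 t, δ < |Mfun σ Φ (fun (_ : ℝ) (_ : T3) => (0 : V3)) χ N z τ - (Rhs σ Φ φ (fun (_ : ℝ) (_ : T3) => (0 : V3)) χ N z τ + Kfun σ Φ φ (fun (_ : ℝ) (_ : T3) => (0 : V3)) χ N z τ)|}) atTop (𝓝 0) :=
  ⟨collisionalEnergyFluxLaw_of_item, item_of_collisionalEnergyFluxLaw⟩


/-! ## The `∀ t` ceiling, as a statement (registered stub [S'] of the skeleton, verbatim); the glue [G2] is LANDED (p139073) and used by name -/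

/-- [S'] THE `∀ t` MESOSCALE DILUTE CEILING (registered stub `stub_ceilingAllTimes`, verbatim): needed ONLY by the filed `∀ t` form; false
modulo `PersistentJam` (p118982); pre-shock it is crux 9201 by name (certificate 2 does not use it). -/
def CeilingAllTimes : Prop :=
  ∀ η₁ : ℝ, 0 < η₁ → ∀ (a₀ θ₀ : T3 → ℝ) (u₀ : T3 → V3), NiceProfiles a₀ θ₀ u₀ → ∃ σ₀ : ℝ, 0 < σ₀ ∧ ∀ σ : ℝ, 0 < σ → σ < σ₀ → ∀ (Φ : Flows σ) (t : ℝ), 0 < t → ∀ (γ C : ℝ) (φ : ℕ → T3 → ℝ), 0 < γ → γ ≤ 1 / 15 → AdmissibleKernel γ C φ → DiluteAt σ a₀ θ₀ u₀ Φ t φ η₁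

/-! ## Assembly certificates (copied from the v17 skeleton, items in place of stubs) -/

/-- The zero scalar test is space–time smooth. [folklore] -/
theorem isSmoothSpaceTimeOn_zero_scalar (S : Set ℝ) :
    Literature.Analysis.FunctionSpaces.Torus.IsSmoothSpaceTimeOn S (fun (_ : ℝ) (_ : T3) => (0 : ℝ)) :=
  Literature.Analysis.FunctionSpaces.Torus.isSmoothSpaceTimeOn_const
    (Literature.Analysis.FunctionSpaces.Torus.isSmooth_const (0 : ℝ)) S

/-- The zero vector test is space–time smooth. [folklore] -/
theorem isSmoothSpaceTimeOn_zero_vector (S : Set ℝ) :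
    Literature.Analysis.FunctionSpaces.Torus.IsSmoothSpaceTimeOn S (fun (_ : ℝ) (_ : T3) => (0 : V3)) :=
  Literature.Analysis.FunctionSpaces.Torus.isSmoothSpaceTimeOn_const
    (Literature.Analysis.FunctionSpaces.Torus.isSmooth_const (0 : V3)) S

/-- The dilute event is monotone in the level: a lower ceiling is a smaller event. [folklore] -/
theorem DiluteAt.mono {σ : ℝ} {a₀ θ₀ : T3 → ℝ} {u₀ : T3 → V3} {Φ : Flows σ} {t : ℝ} {φ : ℕ → T3 → ℝ} {η η' : ℝ}
    (hle : η ≤ η') (h : DiluteAt σ a₀ θ₀ u₀ Φ t φ η) : DiluteAt σ a₀ θ₀ u₀ Φ t φ η' := by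
  refine tendsto_of_tendsto_of_tendsto_of_le_of_le tendsto_const_nhds h (fun N => bot_le)
    (fun N => measure_mono ?_)
  rintro z ⟨s, hs, x, hx⟩
  exact ⟨s, hs, x, hle.trans_lt hx⟩

/-- One step of both compositions (v10): at fixed `(σ, profiles, Φ)` with `0 < σ ≤ 1/2`, a kernel family, a horizon
`t > 0`, smooth tests, [V], [M] at the collisional pressure and [C] at this `(kernel, t, ψ, χ)`, the crux's conclusion at
this `(kernel, t, ψ, χ)` holds — [S1] (landed `stub_balanceIdentity`) and the LANDED reduction `stub_markedReduction` (p120490). -/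
theorem conclusion_step' {σ : ℝ} (hσ : 0 < σ) (hhalf : σ ≤ 1 / 2) (a₀ θ₀ : T3 → ℝ)
    (u₀ : T3 → V3) (Φ : Flows σ) (φ : ℕ → T3 → ℝ) {t : ℝ} (ht : 0 < t)
    {ψ : ℝ → T3 → V3} {χ : ℝ → T3 → ℝ}
    (hψ : Literature.Analysis.FunctionSpaces.Torus.IsSmoothSpaceTimeOn (Icc 0 t) ψ)
    (hχ : Literature.Analysis.FunctionSpaces.Torus.IsSmoothSpaceTimeOn (Icc 0 t) χ)
    (hV : VirialBounded σ a₀ θ₀ u₀ Φ t)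
    (hM : ∀ δ : ℝ, 0 < δ → Tendsto (fun N : ℕ =>
      Literature.MathematicalPhysics.KineticTheory.localGibbsLaw σ a₀ u₀ θ₀ N (Φ N)
        {z | ∃ τ ∈ Icc 0 t, δ < |Mfun σ Φ ψ χ N z τ - (Rhs σ Φ φ ψ χ N z τ + Kfun σ Φ φ ψ χ N z τ)|})
          atTop (𝓝 0))
    (hC : RelaxC σ a₀ θ₀ u₀ Φ φ t ψ χ) :
    ∀ δ : ℝ, 0 < δ → Tendsto (fun N : ℕ =>
      Literature.MathematicalPhysics.KineticTheory.localGibbsLaw σ a₀ u₀ θ₀ N (Φ N)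
        {z | ∃ τ ∈ Icc 0 t, δ < |Cc σ Φ ψ χ N z τ - Rhs σ Φ φ ψ χ N z τ|}) atTop (𝓝 0) :=
  Summit.AtomisticToContinuum.HydrodynamicLimit.Theorems.HemisphereAffineSlaving.stub_markedReduction σ hσ hhalf a₀ θ₀ u₀ Φ (stub_balanceIdentity σ hσ hhalf Φ) φ ht hψ hχ hV hM hC

/-- **One step of the v16 compositions, by channel.** At fixed `(σ, profiles, Φ)` with `0 < σ ≤ 1/2`, the linear
`Z`-bound, a dilute level `η₁ ≤ η_Z` with the dilute event, continuous nonnegative kernels, a horizon `t > 0`, smooth tests,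
[V], [M] at the collisional pressure in EACH channel (`(ψ, 0)` and `(0, χ)`) and [C] in each channel: the crux's conclusion
at `(ψ, χ)` — two calls of `conclusion_step'` (landed `stub_markedReduction` + [S1]) and the glue [G2]. -/
theorem conclusion_of_channels {σ : ℝ} (hσ : 0 < σ) (hhalf : σ ≤ 1 / 2) {ηZ K : ℝ} (hηZ : 0 < ηZ) (hK : 0 ≤ K)
    (hZK : ∀ η : ℝ, 0 ≤ η → η ≤ ηZ → |Literature.MathematicalPhysics.KineticTheory.hsCompressibility η - 1| ≤ K * η)
    {η₁ : ℝ} (hη₁0 : 0 < η₁) (hη₁Z : η₁ ≤ ηZ) (a₀ θ₀ : T3 → ℝ) (u₀ : T3 → V3) (Φ : Flows σ)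
    (φ : ℕ → T3 → ℝ) {t : ℝ} (ht : 0 < t) (hφc : ∀ N, Continuous (φ N)) (hφ0 : ∀ N y, 0 ≤ φ N y)
    (hDil : DiluteAt σ a₀ θ₀ u₀ Φ t φ η₁) {ψ : ℝ → T3 → V3} {χ : ℝ → T3 → ℝ}
    (hψ : Literature.Analysis.FunctionSpaces.Torus.IsSmoothSpaceTimeOn (Icc 0 t) ψ)
    (hχ : Literature.Analysis.FunctionSpaces.Torus.IsSmoothSpaceTimeOn (Icc 0 t) χ)
    (hV : VirialBounded σ a₀ θ₀ u₀ Φ t)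
    (hMψ : ∀ δ : ℝ, 0 < δ → Tendsto (fun N : ℕ =>
      Literature.MathematicalPhysics.KineticTheory.localGibbsLaw σ a₀ u₀ θ₀ N (Φ N)
        {z | ∃ τ ∈ Icc 0 t, δ < |Mfun σ Φ ψ (fun (_ : ℝ) (_ : T3) => (0 : ℝ)) N z τ -
          (Rhs σ Φ φ ψ (fun (_ : ℝ) (_ : T3) => (0 : ℝ)) N z τ + Kfun σ Φ φ ψ (fun (_ : ℝ) (_ : T3) => (0 : ℝ)) N z τ)|}) atTop (𝓝 0))
    (hMχ : ∀ δ : ℝ, 0 < δ → Tendsto (fun N : ℕ =>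
      Literature.MathematicalPhysics.KineticTheory.localGibbsLaw σ a₀ u₀ θ₀ N (Φ N)
        {z | ∃ τ ∈ Icc 0 t, δ < |Mfun σ Φ (fun (_ : ℝ) (_ : T3) => (0 : V3)) χ N z τ -
          (Rhs σ Φ φ (fun (_ : ℝ) (_ : T3) => (0 : V3)) χ N z τ + Kfun σ Φ φ (fun (_ : ℝ) (_ : T3) => (0 : V3)) χ N z τ)|}) atTop (𝓝 0))
    (hCψ : RelaxC σ a₀ θ₀ u₀ Φ φ t ψ (fun (_ : ℝ) (_ : T3) => (0 : ℝ))) (hCχ : RelaxC σ a₀ θ₀ u₀ Φ φ t (fun (_ : ℝ) (_ : T3) => (0 : V3)) χ) :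
    ∀ δ : ℝ, 0 < δ → Tendsto (fun N : ℕ =>
      Literature.MathematicalPhysics.KineticTheory.localGibbsLaw σ a₀ u₀ θ₀ N (Φ N)
        {z | ∃ τ ∈ Icc 0 t, δ < |Cc σ Φ ψ χ N z τ - Rhs σ Φ φ ψ χ N z τ|}) atTop (𝓝 0) :=
  (Summit.AtomisticToContinuum.HydrodynamicLimit.Theorems.HemisphereAffineSlaving.stub_channelAdditivity σ hσ hhalf ηZ K hηZ hK hZK η₁ hη₁0 hη₁Z a₀ θ₀ u₀ Φ φ t ht hφc hφ0 hDil ψ χ hψ hχ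
    (conclusion_step' hσ hhalf a₀ θ₀ u₀ Φ φ ht hψ (isSmoothSpaceTimeOn_zero_scalar _) hV hMψ hCψ)
    (conclusion_step' hσ hhalf a₀ θ₀ u₀ Φ φ ht (isSmoothSpaceTimeOn_zero_vector _) hχ hV hMχ hCχ))

/-- **ASSEMBLY CERTIFICATE 1 — the FILED `∀ t` crux from named route items 9522 + 15144 + the two engine ITEMS + the `∀ t` ceiling [S'] (landed glue [G2] by name).** (Verbatim the skeleton theorem `CollisionalTransferLocality_of` of v17 with the items in place of the registered stubs.) From the Stiff route's `∀ t` kinetic hinge 9522 (`FastMomentRelaxation`)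
and the collision-moment tightness item 15144 (`InformationPercolationEngine.CollisionMomentBound`, which gives [V] —
`virialBounded_of_collisionMomentBound`) BY NAME, the two ENGINE stubs [Kσ] `stub_collisionalStressLaw` and [Kq]
`stub_collisionalEnergyFluxLaw` (research; dilute levels `η_ψ`, `η_χ`), the provable glue [G2] `stub_channelAdditivity`, the landed
reduction (`conclusion_of_channels`), the landed stubs [C]° (once per channel), [E], [Z], and the one `∀ t` a-priori stub [S'] at the
dilute level `η⋆ := min η_Z (min η_ψ η_χ)` (`DiluteAt` is monotone in the level, `DiluteAt.mono`):
`σ₀ := min (min σ_9522 σ_15144) (min (min σ_[Kσ] σ_[Kq]) (min σ_[S'] (1/2)))`. No statics enter the composition any more (the contact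
theorem and `Z` sit inside [Kσ]/[Kq]). The conclusion at `(σ, profiles, Φ)` is definitionally the crux's `let`-telescope
(`conclusionAtFlow_iff`). -/
theorem collisionalTransferLocality_of_items
    (hF : Summit.AtomisticToContinuum.HydrodynamicLimit.Theses.StiffCollisionalRelaxation.FastMomentRelaxation)
    (hM : Summit.AtomisticToContinuum.HydrodynamicLimit.Theses.InformationPercolationEngine.CollisionMomentBound)
    (hKσ : MesoscaleCollisionalStressLaw) (hKq : MesoscaleCollisionalEnergyFluxLaw) (hS : CeilingAllTimes) :
    Summit.AtomisticToContinuum.HydrodynamicLimit.Theses.StiffCollisionalRelaxation.CollisionalTransferLocality := by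
  intro a₀ θ₀ u₀ ha hθ hu ha0 hθ0
  have hP : NiceProfiles a₀ θ₀ u₀ := ⟨ha, hθ, hu, ha0, hθ0⟩
  obtain ⟨ηZ, hηZ, K, hK0, hZK⟩ := Summit.AtomisticToContinuum.HydrodynamicLimit.Theorems.HemisphereAffineSlaving.stub_hsCompressibility_linear
  obtain ⟨σF, hσF, HF⟩ := hF a₀ θ₀ u₀ ha hθ hu ha0 hθ0
  obtain ⟨σV, hσV, HV⟩ := virialBounded_of_collisionMomentBound hM a₀ θ₀ u₀ hP
  obtain ⟨σBψ, hσBψ, ηψ, hηψ, HBψ⟩ := (collisionalStressLaw_of_item hKσ) a₀ θ₀ u₀ hP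
  obtain ⟨σBχ, hσBχ, ηχ, hηχ, HBχ⟩ := (collisionalEnergyFluxLaw_of_item hKq) a₀ θ₀ u₀ hP
  set ηs : ℝ := min ηZ (min ηψ ηχ) with hηs
  have hηs0 : 0 < ηs := lt_min hηZ (lt_min hηψ hηχ)
  have hηsZ : ηs ≤ ηZ := min_le_left _ _
  have hηsψ : ηs ≤ ηψ := (min_le_right _ _).trans (min_le_left _ _)
  have hηsχ : ηs ≤ ηχ := (min_le_right _ _).trans (min_le_right _ _)
  obtain ⟨σS, hσS, HS⟩ := (hS : CeilingAllTimes) ηs hηs0 a₀ θ₀ u₀ hP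
  have HC := Summit.AtomisticToContinuum.HydrodynamicLimit.Theorems.HemisphereAffineSlaving.stub_weightedKineticRelaxationDilute ηZ K hηZ hK0 hZK ηs hηs0 hηsZ
  have HE := Summit.AtomisticToContinuum.HydrodynamicLimit.Theorems.HemisphereAffineSlaving.stub_energyAllTimes a₀ θ₀ u₀ hP
  refine ⟨min (min σF σV) (min (min σBψ σBχ) (min σS (1 / 2))), ?_, ?_⟩
  · exact lt_min (lt_min hσF hσV) (lt_min (lt_min hσBψ hσBχ) (lt_min hσS (by norm_num)))
  intro σ hσ hlt
  have hltF : σ < σF := lt_of_lt_of_le hlt ((min_le_left _ _).trans (min_le_left _ _))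
  have hltV : σ < σV := lt_of_lt_of_le hlt ((min_le_left _ _).trans (min_le_right _ _))
  have hltBψ : σ < σBψ := lt_of_lt_of_le hlt
    ((min_le_right _ _).trans ((min_le_left _ _).trans (min_le_left _ _)))
  have hltBχ : σ < σBχ := lt_of_lt_of_le hlt
    ((min_le_right _ _).trans ((min_le_left _ _).trans (min_le_right _ _)))
  have hltS : σ < σS := lt_of_lt_of_le hlt
    ((min_le_right _ _).trans ((min_le_right _ _).trans (min_le_left _ _)))
  have hhalf : σ ≤ 1 / 2 :=
    (lt_of_lt_of_le hlt ((min_le_right _ _).trans ((min_le_right _ _).trans (min_le_right _ _)))).le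
  intro Φ
  obtain ⟨E₀, -, HEt⟩ := HE σ hσ hhalf Φ
  show ConclusionAtFlow σ a₀ θ₀ u₀ Φ
  rw [conclusionAtFlow_iff]
  intro γ C φ hγ hγ' hadm t ht ψ χ hψ hχ
  have hEner := HEt t
  have hDil : DiluteAt σ a₀ θ₀ u₀ Φ t φ ηs := HS σ hσ hltS Φ t ht γ C φ hγ hγ' hadm
  have hVir : VirialBounded σ a₀ θ₀ u₀ Φ t := HV σ hσ hltV Φ t ht
  have hφc : ∀ N, Continuous (φ N) := fun N => (hadm.1 N).continuous
  have hφ0 : ∀ N y, 0 ≤ φ N y := hadm.2.1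
  have hFloc : ∀ δ : ℝ, 0 < δ → Tendsto (fun N : ℕ =>
      Literature.MathematicalPhysics.KineticTheory.localGibbsLaw σ a₀ u₀ θ₀ N (Φ N)
        {z | δ < ∫ s in Icc 0 t, ∫ x, ((∑ j, ∑ k, Dst φ N ((Φ N).flow s z) x j k ^ 2) +
          ‖qfl φ N ((Φ N).flow s z) x‖ ^ 2)}) atTop (𝓝 0) :=
    fun δ hδ => HF σ hσ hltF Φ γ C φ hγ hγ' hadm t ht δ hδ
  have h0χ := isSmoothSpaceTimeOn_zero_scalar (Icc 0 t)
  have h0ψ := isSmoothSpaceTimeOn_zero_vector (Icc 0 t)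
  exact conclusion_of_channels hσ hhalf hηZ hK0 hZK hηs0 hηsZ a₀ θ₀ u₀ Φ φ ht hφc hφ0 hDil hψ hχ hVir
    (HBψ σ hσ hltBψ Φ t ht hVir γ C φ hγ hγ' hadm (DiluteAt.mono hηsψ hDil) ψ hψ)
    (HBχ σ hσ hltBχ Φ t ht hVir γ C φ hγ hγ' hadm (DiluteAt.mono hηsχ hDil) χ hχ)
    (HC σ hσ a₀ θ₀ u₀ Φ t E₀ ht hEner γ C φ hγ hγ' hadm hDil hFloc ψ _ hψ h0χ)
    (HC σ hσ a₀ θ₀ u₀ Φ t E₀ ht hEner γ C φ hγ hγ' hadm hDil hFloc _ χ h0ψ hχ)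

/-- **ASSEMBLY CERTIFICATE 2 — the PRE-SHOCK form (`…DefsB.CollisionalTransferLocalityPreShock`, seat c1's C′) from named route items 9522 + 15144 + 9201 + the two engine ITEMS ONLY (landed glue by name); NO `∀ t` input, NO statics.** (Verbatim the skeleton theorem `collisionalTransferLocalityPreShock_of` of v17.) From the Stiff route's `∀ t` kinetic hinge 9522, the
collision-moment tightness 15144 (⇒ [V]) and the kinetic range control 9201 (⇒ [D], `stub_diluteBlocks_of_kineticRangeControl`)
BY NAME, the engine stubs [Kσ], [Kq] (v17; v16: [M-ψ]°, [M-χ]°; v10–v15: [M]°), the glue [G2], the landed reduction `stub_markedReduction`, the landed stubs [C]°, [E], [Z]: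
`CollisionalTransferLocalityPreShock` with the dilute level `η⋆ := min (min η_Z ηbar) (min η_ψ η_χ)` (`ηbar` from [D], `η_ψ, η_χ` from [Kσ], [Kq]) as the
chamber level and `σ₀ := min (σ_9522, σ_15144, σ_[Kσ], σ_[Kq], σ_[D], 1/2)`. NO `∀ t` stub, NO statics. -/
theorem collisionalTransferLocalityPreShock_of_items
    (hF : Summit.AtomisticToContinuum.HydrodynamicLimit.Theses.StiffCollisionalRelaxation.FastMomentRelaxation)
    (hM : Summit.AtomisticToContinuum.HydrodynamicLimit.Theses.InformationPercolationEngine.CollisionMomentBound)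
    (hKσ : MesoscaleCollisionalStressLaw) (hKq : MesoscaleCollisionalEnergyFluxLaw)
    (hK : Summit.AtomisticToContinuum.HydrodynamicLimit.Theses.GermanoSplitLES.KineticRangeControl) :
    CollisionalTransferLocalityPreShock := by
  intro a₀ θ₀ u₀ ha hθ hu ha0 hθ0
  have hP : NiceProfiles a₀ θ₀ u₀ := ⟨ha, hθ, hu, ha0, hθ0⟩
  obtain ⟨ηZ, hηZ, K, hK0, hZK⟩ := Summit.AtomisticToContinuum.HydrodynamicLimit.Theorems.HemisphereAffineSlaving.stub_hsCompressibility_linear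
  obtain ⟨ηbar, hηbar, HD0⟩ := stub_diluteBlocks_of_kineticRangeControl hK a₀ θ₀ u₀ hP
  obtain ⟨σBψ, hσBψ, ηψ, hηψ, HBψ⟩ := (collisionalStressLaw_of_item hKσ) a₀ θ₀ u₀ hP
  obtain ⟨σBχ, hσBχ, ηχ, hηχ, HBχ⟩ := (collisionalEnergyFluxLaw_of_item hKq) a₀ θ₀ u₀ hP
  set ηs : ℝ := min (min ηZ ηbar) (min ηψ ηχ) with hηs
  have hηs0 : 0 < ηs := lt_min (lt_min hηZ hηbar) (lt_min hηψ hηχ)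
  have hηsZ : ηs ≤ ηZ := (min_le_left _ _).trans (min_le_left _ _)
  have hηs2 : ηs ≤ ηbar := (min_le_left _ _).trans (min_le_right _ _)
  have hηsψ : ηs ≤ ηψ := (min_le_right _ _).trans (min_le_left _ _)
  have hηsχ : ηs ≤ ηχ := (min_le_right _ _).trans (min_le_right _ _)
  obtain ⟨σF, hσF, HF⟩ := hF a₀ θ₀ u₀ ha hθ hu ha0 hθ0
  obtain ⟨σV, hσV, HV⟩ := virialBounded_of_collisionMomentBound hM a₀ θ₀ u₀ hP
  obtain ⟨σD, hσD, HD⟩ := HD0 ηs hηs0 hηs2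
  have HC := Summit.AtomisticToContinuum.HydrodynamicLimit.Theorems.HemisphereAffineSlaving.stub_weightedKineticRelaxationDilute ηZ K hηZ hK0 hZK ηs hηs0 hηsZ
  have HE := Summit.AtomisticToContinuum.HydrodynamicLimit.Theorems.HemisphereAffineSlaving.stub_energyAllTimes a₀ θ₀ u₀ hP
  refine ⟨min (min σF σV) (min (min σBψ σBχ) (min σD (1 / 2))), ?_, ηs, hηs0, ?_⟩
  · exact lt_min (lt_min hσF hσV) (lt_min (lt_min hσBψ hσBχ) (lt_min hσD (by norm_num)))
  intro σ hσ hlt T ρ θ u hsol Φ hlln γ C φ hγ hγ' hadm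
  have hltF : σ < σF := lt_of_lt_of_le hlt ((min_le_left _ _).trans (min_le_left _ _))
  have hltV : σ < σV := lt_of_lt_of_le hlt ((min_le_left _ _).trans (min_le_right _ _))
  have hltBψ : σ < σBψ := lt_of_lt_of_le hlt
    ((min_le_right _ _).trans ((min_le_left _ _).trans (min_le_left _ _)))
  have hltBχ : σ < σBχ := lt_of_lt_of_le hlt
    ((min_le_right _ _).trans ((min_le_left _ _).trans (min_le_right _ _)))
  have hltD : σ < σD := lt_of_lt_of_le hlt
    ((min_le_right _ _).trans ((min_le_right _ _).trans (min_le_left _ _)))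
  have hhalf : σ ≤ 1 / 2 :=
    (lt_of_lt_of_le hlt ((min_le_right _ _).trans ((min_le_right _ _).trans (min_le_right _ _)))).le
  obtain ⟨E₀, -, HEt⟩ := HE σ hσ hhalf Φ
  intro ρb mb Eb ub θb pc t ht htT hdil ψ χ hψ hχ O Cc' δ hδ
  have hEner := HEt t
  have hDil : DiluteAt σ a₀ θ₀ u₀ Φ t φ ηs :=
    HD σ hσ hltD T ρ θ u hsol Φ hlln t ht htT hdil γ C φ hγ hγ' hadm
  have hVir : VirialBounded σ a₀ θ₀ u₀ Φ t := HV σ hσ hltV Φ t ht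
  have hFloc : ∀ δ : ℝ, 0 < δ → Tendsto (fun N : ℕ =>
      Literature.MathematicalPhysics.KineticTheory.localGibbsLaw σ a₀ u₀ θ₀ N (Φ N)
        {z | δ < ∫ s in Icc 0 t, ∫ x, ((∑ j, ∑ k, Dst φ N ((Φ N).flow s z) x j k ^ 2) +
          ‖qfl φ N ((Φ N).flow s z) x‖ ^ 2)}) atTop (𝓝 0) :=
    fun δ hδ => HF σ hσ hltF Φ γ C φ hγ hγ' hadm t ht δ hδ
  have hφc : ∀ N, Continuous (φ N) := fun N => (hadm.1 N).continuous
  have hφ0 : ∀ N y, 0 ≤ φ N y := hadm.2.1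
  have h0χ := isSmoothSpaceTimeOn_zero_scalar (Icc 0 t)
  have h0ψ := isSmoothSpaceTimeOn_zero_vector (Icc 0 t)
  exact conclusion_of_channels hσ hhalf hηZ hK0 hZK hηs0 hηsZ a₀ θ₀ u₀ Φ φ ht hφc hφ0 hDil hψ hχ hVir
    (HBψ σ hσ hltBψ Φ t ht hVir γ C φ hγ hγ' hadm (DiluteAt.mono hηsψ hDil) ψ hψ)
    (HBχ σ hσ hltBχ Φ t ht hVir γ C φ hγ hγ' hadm (DiluteAt.mono hηsχ hDil) χ hχ)
    (HC σ hσ a₀ θ₀ u₀ Φ t E₀ ht hEner γ C φ hγ hγ' hadm hDil hFloc ψ _ hψ h0χ)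
    (HC σ hσ a₀ θ₀ u₀ Φ t E₀ ht hEner γ C φ hγ hγ' hadm hDil hFloc _ χ h0ψ hχ) δ hδ


end

end Summit.AtomisticToContinuum.HydrodynamicLimit.Theorems.HemisphereAffineSlaving.EngineItems
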